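import Mathlib.Analysis.Fourier.Inversion
import Mathlib.Analysis.SpecialFunctions.JapaneseBracket
import Mathlib.Analysis.Real.Pi.Bounds
import Literature.Analysis.FunctionSpaces.BesselJPoissonIntegral
import HarnessLib

/-!
# The Weber–Schafheitlin integral `∫₀^∞ J₀(y) J₁(y) dy / y = 2/π`

This file proves, from the series definition of the Bessel functions `Literature.Analysis.FunctionSpaces.besselJ`
(`Literature.Analysis.FunctionSpaces.BesselJ`) and the Poisson integrals of
`Literature.Analysis.FunctionSpaces.BesselJPoissonIntegral`, the value

* `Literature.Analysis.FunctionSpaces.integral_Ioi_besselJ_zero_mul_besselJ_one_div`: `∫₀^∞ J₀(y) J₁(y) / y dy = 2/π`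
* `Literature.Analysis.FunctionSpaces.integral_Ioi_besselJ_one_div`: `∫₀^∞ J₁(y) / y dy = 1` (Fourier inversion at `0`; the input
  for the vanishing of the Lieb–Wu charge gap at `U = 0`, `Literature.Analysis.FunctionSpaces.liebWuChargeGap_zero`)

(the first a critical case of the Weber–Schafheitlin discontinuous integral; Andrews–Askey–Roy, Exercise 4.15
with `a = 1`, `α = β = 1/2`, `γ = 2`; Watson §13.42), which is the Bessel-function input for the
free-fermion limit `e(U) → -4/π` (`U → 0⁺`) of the Lieb–Wu ground-state energy of the half-filled
Hubbard chain (`Literature.Analysis.FunctionSpaces.LiebWuIntegrals`,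
`Literature.Analysis.FunctionSpaces.tendsto_liebWuEnergy_zero`): `-4 ∫₀^∞ J₀J₁/(2ω) dω = -4/π`.

## Proof

The proof is Parseval's relation between the arcsine law `dt/(π√(1-t²))` on `(-1, 1)`, whose
Fourier transform is `J₀` (Poisson's integral `J₀(y) = π⁻¹ ∫₀^π cos(y cos θ) dθ`), and the semicircle
profile `g(t) = √(1-t²)₊`, whose Fourier transform is `π J₁(y)/y` (Poisson's integral for `J₁`;
Lieb–Wu, Physica A 321 (2003) 1, §7.1 use exactly this transform with Plancherel's theorem):

1. `Literature.Analysis.FunctionSpaces.fourier_semicircle`: with Mathlib's normalisation `𝓕 g(ξ) = ∫ e^{-2πi tξ} g(t) dt`, the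
   substitution `t = cos θ` gives `𝓕 g(ξ) = ∫₀^π cos(2πξ cos θ) sin²θ dθ` (the sine part vanishes
   under `θ ↦ π - θ`), `= π J₁(2πξ)/(2πξ)` for `ξ ≠ 0` (`Literature.Analysis.FunctionSpaces.fourier_semicircle_eq_besselJ_one_div`).
2. `Literature.Analysis.FunctionSpaces.integrable_fourier_semicircle`: `|J₁(y)/y| ≤ K (1+|y|)^{-3/2}` (from `|J₁(y)| ≤ |y|/2` and the
   decay `|J₁(x)| ≤ C x^{-1/2}`, `x ≥ 2`, of `BesselJProofs`), so `𝓕 g` is integrable; hence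
   Mathlib's Fourier inversion theorem (`Continuous.fourierInv_fourier_eq`) applies and yields
   `∫ cos(2πξs) 𝓕g(ξ) dξ = g(s)` for every `s` (`Literature.Analysis.FunctionSpaces.integral_cos_mul_fourier_semicircle`).
3. `Literature.Analysis.FunctionSpaces.integral_besselJ_zero_mul_fourier_semicircle`: inserting Poisson's integral for `J₀(2πξ)`,
   Fubini (justified by 2.) and 2. at `s = cos θ` give
   `∫ J₀(2πξ) 𝓕g(ξ) dξ = π⁻¹ ∫₀^π sin θ dθ = 2/π`.
4. `Literature.Analysis.FunctionSpaces.integral_besselJ_zero_mul_fourier_semicircle_eq_integral_Ioi`: by 1., the substitution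
   `y = 2πξ` and evenness, the same integral is `∫₀^∞ J₀(y) J₁(y)/y dy`.

## References

* G. E. Andrews, R. Askey, R. Roy, *Special Functions* (Cambridge, 1999), §4.9 (4.9.12) (Poisson's
  integrals), Exercises 4.14–4.15 (the Weber–Schafheitlin integral
  `∫₀^∞ J_{α-β}(at) J_{γ-1}(at) t^{α+β-γ} dt = (a/2)^{γ-α-β-1} Γ(γ-α-β)Γ(α) / (2Γ(1-β)Γ(γ-α)Γ(γ-β))`).
* G. N. Watson, *A Treatise on the Theory of Bessel Functions* (2nd ed., 1944), §13.4, §13.42.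
* E. H. Lieb, F. Y. Wu, *The one-dimensional Hubbard model: a reminiscence*, Physica A 321 (2003)
  1–27 (arXiv:cond-mat/0207529), §6 (energy formula, Remark (A)), §7.1 (Fourier transform of
  `√(1-x²)`, Plancherel).
* Mathlib: `Mathlib.Analysis.Fourier.Inversion` (Fourier inversion formula).
-/

noncomputable section

open scoped Topology FourierTransform
open Filter Set MeasureTheory intervalIntegral Real

namespace Literature.Analysis.FunctionSpaces

/-- The semicircle profile `g(t) = √(1 - t²)` for `|t| ≤ 1` and `0` otherwise, as a complex-valued
function on `ℝ` (so that Mathlib's Fourier transform `𝓕` and inversion theorem apply). [folklore] -/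
def semicircle (t : ℝ) : ℂ := ((√(1 - t ^ 2) : ℝ) : ℂ)

/-- Unfolding of `Literature.Analysis.FunctionSpaces.semicircle`: `semicircle t = √(1 - t²)` (with `√` of a negative number `= 0`). [folklore] -/
theorem semicircle_apply (t : ℝ) : semicircle t = ((√(1 - t ^ 2) : ℝ) : ℂ) := rfl

/-- The semicircle profile is even. [folklore] -/
theorem semicircle_neg (t : ℝ) : semicircle (-t) = semicircle t := by
  simp [semicircle]

/-- The semicircle profile is continuous. [folklore] -/
theorem continuous_semicircle : Continuous semicircle := by
  unfold semicircle; fun_prop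

/-- The semicircle profile vanishes off `(-1, 1)`. [folklore] -/
theorem semicircle_eq_zero {t : ℝ} (ht : 1 ≤ |t|) : semicircle t = 0 := by
  have h : 1 - t ^ 2 ≤ 0 := by nlinarith [sq_abs t, abs_nonneg t]
  simp [semicircle, Real.sqrt_eq_zero'.mpr h]

/-- The support of the semicircle profile lies in `(-1, 1]` (indeed in `(-1, 1)`). [folklore] -/
theorem support_semicircle_subset : Function.support semicircle ⊆ Ioc (-1) 1 := by
  intro t ht
  rw [Function.mem_support] at ht
  by_contra h
  apply ht
  apply semicircle_eq_zero
  rw [mem_Ioc, not_and_or, not_lt, not_le] at h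
  rcases h with h | h
  · rw [abs_of_nonpos (by linarith)]; linarith
  · rw [abs_of_pos (by linarith)]; linarith

/-- The semicircle profile has compact support. [folklore] -/
theorem hasCompactSupport_semicircle : HasCompactSupport semicircle :=
  HasCompactSupport.intro (isCompact_Icc (a := (-1 : ℝ)) (b := 1)) fun _ ht =>
    Function.notMem_support.mp fun h => ht (Ioc_subset_Icc_self (support_semicircle_subset h))

/-- The semicircle profile is integrable. [folklore] -/
theorem integrable_semicircle : Integrable semicircle :=
  continuous_semicircle.integrable_of_hasCompactSupport hasCompactSupport_semicircle

/-- `sin(c cos θ) sin²θ` integrates to zero over `[0, π]` (odd under `θ ↦ π - θ`). [folklore] -/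
theorem integral_sin_mul_cos_mul_sin_sq (c : ℝ) :
    ∫ θ in (0 : ℝ)..π, Real.sin (c * cos θ) * sin θ ^ 2 = 0 := by
  have h := intervalIntegral.integral_comp_sub_left
    (fun θ => Real.sin (c * cos θ) * sin θ ^ 2) π (a := 0) (b := π)
  simp only [sub_self, sub_zero, cos_pi_sub, sin_pi_sub, mul_neg, Real.sin_neg, neg_mul] at h
  rw [intervalIntegral.integral_neg] at h
  linarith

/-- **Fourier transform of the semicircle**: for every real `ξ`,
`𝓕 g(ξ) = ∫ e^{-2πi t ξ} √(1-t²)₊ dt = ∫₀^π cos(2π ξ cos θ) sin²θ dθ` (substitute `t = cos θ`; the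
sine part vanishes by symmetry). With Poisson's integral this is `π J₁(2πξ)/(2πξ)`
(`Literature.Analysis.FunctionSpaces.fourier_semicircle_eq_besselJ_one_div`); Lieb–Wu, Physica A 321 (2003) 1, §7.1:
`∫_{-1}^1 √(1-x²) e^{iωx} dx = 2∫₀^{π/2} cos(ω sin θ) cos²θ dθ = (π/ω) J₁(ω)`. [cite: LiebWuPhysicaA2003, §7.1, Fourier transform of √(1-x²)] -/
theorem fourier_semicircle (ξ : ℝ) :
    𝓕 semicircle ξ = ((∫ θ in (0 : ℝ)..π, Real.cos (2 * π * ξ * cos θ) * sin θ ^ 2 : ℝ) : ℂ) := by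
  rw [Real.fourier_real_eq_integral_exp_smul]
  set G : ℝ → ℂ := fun v => Complex.exp (↑(-2 * π * v * ξ) * Complex.I) • semicircle v with hG
  have hGc : Continuous G := by
    rw [hG]
    exact (Complex.continuous_exp.comp (by fun_prop)).smul continuous_semicircle
  have hsupp : Function.support G ⊆ Ioc (-1) 1 := by
    refine subset_trans (fun v hv => ?_) support_semicircle_subset
    rw [Function.mem_support] at hv ⊢
    intro h0
    exact hv (by rw [hG]; simp only [h0, smul_zero])
  rw [← intervalIntegral.integral_eq_integral_of_support_subset hsupp]
  -- substitution `v = cos θ`, `θ ∈ [0, π]`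
  have hsub := intervalIntegral.integral_deriv_smul_comp (a := π) (b := 0) (f := cos)
    (f' := fun x => -sin x) (g := G) (fun x _ => hasDerivAt_cos x) (by fun_prop) hGc
  rw [cos_pi, cos_zero] at hsub
  rw [← hsub, integral_symm, ← intervalIntegral.integral_neg, ← intervalIntegral.integral_ofReal]
  -- split the complex exponential into cosine and sine parts
  have hsplit : EqOn (fun x => -((-sin x) • (G ∘ cos) x))
      (fun x => ((Real.cos (2 * π * ξ * cos x) * sin x ^ 2 : ℝ) : ℂ) +
        ((-(Real.sin (2 * π * ξ * cos x) * sin x ^ 2) : ℝ) : ℂ) * Complex.I) (uIcc 0 π) := by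
    intro x hx
    rw [uIcc_of_le pi_pos.le] at hx
    have hs : √(1 - cos x ^ 2) = sin x := (sin_eq_sqrt_one_sub_cos_sq hx.1 hx.2).symm
    simp only [Function.comp_apply, hG, semicircle, hs, neg_smul, neg_neg, Complex.real_smul]
    have he : Complex.exp (↑(-2 * π * cos x * ξ) * Complex.I) =
        (Real.cos (2 * π * ξ * cos x) : ℂ) - (Real.sin (2 * π * ξ * cos x) : ℂ) * Complex.I := by
      rw [Complex.exp_mul_I, ← Complex.ofReal_cos, ← Complex.ofReal_sin]
      have : (-2 * π * cos x * ξ : ℝ) = -(2 * π * ξ * cos x) := by ring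
      rw [this, Real.cos_neg, Real.sin_neg]
      push_cast
      ring
    rw [he]
    push_cast
    ring
  rw [intervalIntegral.integral_congr hsplit]
  have hi1 : IntervalIntegrable (fun x => ((Real.cos (2 * π * ξ * cos x) * sin x ^ 2 : ℝ) : ℂ))
      volume 0 π := (Continuous.intervalIntegrable (by fun_prop) _ _)
  have hi2 : IntervalIntegrable
      (fun x => ((-(Real.sin (2 * π * ξ * cos x) * sin x ^ 2) : ℝ) : ℂ) * Complex.I) volume 0 π :=
    (Continuous.intervalIntegrable (by fun_prop) _ _)
  rw [intervalIntegral.integral_add hi1 hi2, intervalIntegral.integral_mul_const,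
    intervalIntegral.integral_ofReal, intervalIntegral.integral_ofReal, intervalIntegral.integral_neg,
    integral_sin_mul_cos_mul_sin_sq]
  simp


/-! ## Decay of `J₁(y)/y` and integrability of the Fourier transform of the semicircle -/

/-- `|J₁(|y|)| = |J₁(y)|` (`J₁` is odd). [folklore] -/
theorem abs_besselJ_one_abs (y : ℝ) : |besselJ 1 (|y|)| = |besselJ 1 y| := by
  rcases le_or_gt 0 y with hy | hy
  · rw [abs_of_nonneg hy]
  · rw [abs_of_neg hy, besselJ_neg, pow_one, neg_one_mul, abs_neg]

/-- Decay of `J₁(y)/y`: there is `K ≥ 0` with `|J₁(y)/y| ≤ K (1 + |y|)^{-3/2}` for all `y ≠ 0`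
(from `|J₁(y)| ≤ |y|/2`, DLMF 10.14.4, and `|J₁(x)| ≤ C x^{-1/2}` for `x ≥ 2`, the Hankel-order decay
DLMF 10.17.3 proved in `BesselJProofs`). [folklore] -/
theorem exists_abs_besselJ_one_div_le :
    ∃ K : ℝ, 0 ≤ K ∧ ∀ y : ℝ, y ≠ 0 → |besselJ 1 y / y| ≤ K * (1 + |y|) ^ (-(3 / 2 : ℝ)) := by
  obtain ⟨C, hC⟩ := abs_besselJ_le_mul_rpow_neg_half 1
  refine ⟨9 / 2 + 4 * |C|, by positivity, fun y hy => ?_⟩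
  have hay : 0 < |y| := abs_pos.mpr hy
  have h1y : (1 : ℝ) ≤ 1 + |y| := by linarith
  have hpos : 0 < (1 + |y|) ^ (-(3 / 2 : ℝ)) := Real.rpow_pos_of_pos (by linarith) _
  rw [abs_div]
  rcases le_or_gt 2 |y| with h2 | h2
  · -- large `|y|`: `|J₁ y| ≤ C |y|^{-1/2}`
    have hJ : |besselJ 1 y| ≤ C * |y| ^ (-(1 / 2 : ℝ)) := by
      have h := hC |y| (by push_cast; linarith)
      rwa [abs_besselJ_one_abs] at h
    have hCle : C * |y| ^ (-(1 / 2 : ℝ)) ≤ |C| * |y| ^ (-(1 / 2 : ℝ)) :=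
      mul_le_mul_of_nonneg_right (le_abs_self C) (Real.rpow_nonneg hay.le _)
    -- `|y|^{-1/2} / |y| = |y|^{-3/2}`
    have hr : |y| ^ (-(1 / 2 : ℝ)) / |y| = |y| ^ (-(3 / 2 : ℝ)) := by
      rw [show (-(3 / 2 : ℝ)) = -(1 / 2 : ℝ) - 1 by norm_num, Real.rpow_sub_one hay.ne']
    -- `|y|^{-3/2} ≤ 4 (1 + |y|)^{-3/2}` for `|y| ≥ 1`
    have hcmp : |y| ^ (-(3 / 2 : ℝ)) ≤ 4 * (1 + |y|) ^ (-(3 / 2 : ℝ)) := by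
      have ha : (1 + |y|) ^ (-(3 / 2 : ℝ)) ≥ (2 * |y|) ^ (-(3 / 2 : ℝ)) :=
        Real.rpow_le_rpow_of_nonpos (by linarith) (by linarith) (by norm_num)
      have hb : (2 * |y|) ^ (-(3 / 2 : ℝ)) = 2 ^ (-(3 / 2 : ℝ)) * |y| ^ (-(3 / 2 : ℝ)) :=
        Real.mul_rpow (by norm_num) hay.le
      have hc : (2 : ℝ) ^ (-(3 / 2 : ℝ)) ≥ 2 ^ (-(2 : ℝ)) :=
        Real.rpow_le_rpow_of_exponent_le (by norm_num) (by norm_num)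
      have hd : (2 : ℝ) ^ (-(2 : ℝ)) = 1 / 4 := by
        rw [Real.rpow_neg (by norm_num), Real.rpow_two]; norm_num
      nlinarith [Real.rpow_nonneg hay.le (-(3 / 2 : ℝ))]
    calc |besselJ 1 y| / |y| ≤ |C| * |y| ^ (-(1 / 2 : ℝ)) / |y| := by gcongr; exact hJ.trans hCle
      _ = |C| * |y| ^ (-(3 / 2 : ℝ)) := by rw [mul_div_assoc, hr]
      _ ≤ |C| * (4 * (1 + |y|) ^ (-(3 / 2 : ℝ))) := by gcongr
      _ ≤ (9 / 2 + 4 * |C|) * (1 + |y|) ^ (-(3 / 2 : ℝ)) := by nlinarith [abs_nonneg C]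
  · -- small `|y|`: `|J₁ y| ≤ |y|/2`
    have hJ : |besselJ 1 y| / |y| ≤ 1 / 2 := by
      rw [div_le_iff₀ hay]
      linarith [abs_besselJ_one_le_half_mul_abs y]
    have hcmp : (1 : ℝ) / 9 ≤ (1 + |y|) ^ (-(3 / 2 : ℝ)) := by
      have ha : (1 + |y|) ^ (-(3 / 2 : ℝ)) ≥ (3 : ℝ) ^ (-(3 / 2 : ℝ)) :=
        Real.rpow_le_rpow_of_nonpos (by linarith) (by linarith) (by norm_num)
      have hc : (3 : ℝ) ^ (-(3 / 2 : ℝ)) ≥ 3 ^ (-(2 : ℝ)) :=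
        Real.rpow_le_rpow_of_exponent_le (by norm_num) (by norm_num)
      have hd : (3 : ℝ) ^ (-(2 : ℝ)) = 1 / 9 := by
        rw [Real.rpow_neg (by norm_num), Real.rpow_two]; norm_num
      linarith
    nlinarith [abs_nonneg C]

/-- The function `J₀(y) J₁(y) / y` is integrable on `ℝ` (it is bounded by `|J₁(y)/y| ≤ K(1+|y|)^{-3/2}`,
an integrable majorant). [folklore] -/
theorem integrable_besselJ_zero_mul_besselJ_one_div :
    Integrable fun y : ℝ => besselJ 0 y * besselJ 1 y / y := by
  obtain ⟨K, hK0, hK⟩ := exists_abs_besselJ_one_div_le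
  have hmeas : AEStronglyMeasurable (fun y : ℝ => besselJ 0 y * besselJ 1 y / y) volume :=
    (((continuous_besselJ_holds 0).mul (continuous_besselJ_holds 1)).measurable.div
      measurable_id).aestronglyMeasurable
  have hint : Integrable (fun y : ℝ => K * (1 + ‖y‖) ^ (-(3 / 2 : ℝ))) :=
    (integrable_one_add_norm (by rw [Module.finrank_self]; norm_num)).const_mul K
  refine hint.mono' hmeas ?_
  have h0 : ∀ᵐ y : ℝ, y ≠ 0 := by
    rw [ae_iff]; simp
  filter_upwards [h0] with y hy
  rw [Real.norm_eq_abs, Real.norm_eq_abs, mul_div_assoc, abs_mul]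
  calc |besselJ 0 y| * |besselJ 1 y / y| ≤ 1 * (K * (1 + |y|) ^ (-(3 / 2 : ℝ))) :=
        mul_le_mul (abs_besselJ_zero_le_one_holds y) (hK y hy) (abs_nonneg _) zero_le_one
    _ = K * (1 + |y|) ^ (-(3 / 2 : ℝ)) := one_mul _

/-- For `ξ ≠ 0` the Fourier transform of the semicircle is `π J₁(2πξ)/(2πξ)` (Poisson's integral
for `J₁`, Andrews–Askey–Roy (4.9.12)); Lieb–Wu, Physica A 321 (2003) 1, §7.1:
`∫_{-1}^1 √(1-x²) e^{iωx} dx = (π/ω) J₁(ω)`. [cite: LiebWuPhysicaA2003, §7.1, Fourier transform of √(1-x²)] -/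
theorem fourier_semicircle_eq_besselJ_one_div {ξ : ℝ} (hξ : ξ ≠ 0) :
    𝓕 semicircle ξ = ((π * (besselJ 1 (2 * π * ξ) / (2 * π * ξ)) : ℝ) : ℂ) := by
  have hy : 2 * π * ξ ≠ 0 := mul_ne_zero (mul_ne_zero two_ne_zero pi_ne_zero) hξ
  rw [fourier_semicircle, besselJ_one_div_eq_integral _ hy, ← mul_assoc, mul_inv_cancel₀ pi_ne_zero,
    one_mul]

/-- Norm of the Fourier transform of the semicircle off the origin: `‖𝓕 g(ξ)‖ = π |J₁(2πξ)/(2πξ)|`. [folklore] -/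
theorem norm_fourier_semicircle {ξ : ℝ} (hξ : ξ ≠ 0) :
    ‖𝓕 semicircle ξ‖ = π * |besselJ 1 (2 * π * ξ) / (2 * π * ξ)| := by
  rw [fourier_semicircle_eq_besselJ_one_div hξ, Complex.norm_real, Real.norm_eq_abs, abs_mul,
    abs_of_pos pi_pos]

/-- The Fourier transform of the semicircle is continuous (as the Fourier transform of an integrable
function). [folklore] -/
theorem continuous_fourier_semicircle : Continuous (𝓕 semicircle) :=
  VectorFourier.fourierIntegral_continuous Real.continuous_fourierChar (innerSL ℝ).continuous₂
    integrable_semicircle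

/-- **The Fourier transform of the semicircle is integrable** (it is continuous and
`O(|ξ|^{-3/2})`). [folklore] -/
theorem integrable_fourier_semicircle : Integrable (𝓕 semicircle) := by
  obtain ⟨K, hK0, hK⟩ := exists_abs_besselJ_one_div_le
  have hint : Integrable (fun ξ : ℝ => π * K * (1 + ‖ξ‖) ^ (-(3 / 2 : ℝ))) :=
    (integrable_one_add_norm (by rw [Module.finrank_self]; norm_num)).const_mul (π * K)
  refine hint.mono' continuous_fourier_semicircle.aestronglyMeasurable ?_
  have h0 : ∀ᵐ ξ : ℝ, ξ ≠ 0 := by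
    rw [ae_iff]; simp
  filter_upwards [h0] with ξ hξ
  have hy : 2 * π * ξ ≠ 0 := mul_ne_zero (mul_ne_zero two_ne_zero pi_ne_zero) hξ
  rw [norm_fourier_semicircle hξ, Real.norm_eq_abs]
  have h1 : |besselJ 1 (2 * π * ξ) / (2 * π * ξ)| ≤ K * (1 + |ξ|) ^ (-(3 / 2 : ℝ)) := by
    refine (hK _ hy).trans (mul_le_mul_of_nonneg_left ?_ hK0)
    refine Real.rpow_le_rpow_of_nonpos (by positivity) ?_ (by norm_num)
    rw [abs_mul, abs_mul, abs_two, abs_of_pos pi_pos]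
    nlinarith [Real.pi_gt_three, abs_nonneg ξ]
  calc π * |besselJ 1 (2 * π * ξ) / (2 * π * ξ)| ≤ π * (K * (1 + |ξ|) ^ (-(3 / 2 : ℝ))) :=
        mul_le_mul_of_nonneg_left h1 pi_pos.le
    _ = π * K * (1 + |ξ|) ^ (-(3 / 2 : ℝ)) := by ring

/-! ## Fourier inversion for the semicircle -/

/-- Fourier inversion for the (continuous, integrable) semicircle profile, whose Fourier transform is
integrable: `𝓕⁻ 𝓕 g = g`. [folklore] -/
theorem fourierInv_fourier_semicircle (s : ℝ) : 𝓕⁻ (𝓕 semicircle) s = semicircle s :=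
  congrFun (continuous_semicircle.fourierInv_fourier_eq integrable_semicircle
    integrable_fourier_semicircle) s

/-- `∫ e^{2πi ξ s} 𝓕g(ξ) dξ = g(s)`. [folklore] -/
theorem integral_cexp_mul_fourier_semicircle (s : ℝ) :
    ∫ ξ : ℝ, Complex.exp (↑(2 * π * ξ * s) * Complex.I) * 𝓕 semicircle ξ = semicircle s := by
  rw [← fourierInv_fourier_semicircle s, Real.fourierInv_eq']
  congr 1
  funext ξ
  rw [smul_eq_mul, RCLike.inner_apply, conj_trivial]
  congr 3
  push_cast
  ring

/-- `∫ e^{-2πi ξ s} 𝓕g(ξ) dξ = g(-s) = g(s)`. [folklore] -/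
theorem integral_cexp_neg_mul_fourier_semicircle (s : ℝ) :
    ∫ ξ : ℝ, Complex.exp (↑(-2 * π * ξ * s) * Complex.I) * 𝓕 semicircle ξ = semicircle s := by
  rw [← semicircle_neg, ← fourierInv_fourier_semicircle (-s), Real.fourierInv_eq_fourier_neg, neg_neg,
    Real.fourier_real_eq_integral_exp_smul]
  rfl

/-- **Cosine form of Fourier inversion for the semicircle**: `∫ cos(2π ξ s) 𝓕g(ξ) dξ = √(1-s²)₊`. [folklore] -/
theorem integral_cos_mul_fourier_semicircle (s : ℝ) :
    ∫ ξ : ℝ, (Real.cos (2 * π * ξ * s) : ℂ) * 𝓕 semicircle ξ = semicircle s := by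
  have hb : ∀ c : ℝ, Integrable fun ξ : ℝ =>
      Complex.exp (↑(c * π * ξ * s) * Complex.I) * 𝓕 semicircle ξ := fun c =>
    integrable_fourier_semicircle.bdd_mul (c := 1) (Continuous.aestronglyMeasurable (by fun_prop))
      (ae_of_all _ fun ξ => by rw [Complex.norm_exp_ofReal_mul_I])
  have h1 := integral_cexp_mul_fourier_semicircle s
  have h2 := integral_cexp_neg_mul_fourier_semicircle s
  have hcos : (fun ξ : ℝ => (Real.cos (2 * π * ξ * s) : ℂ) * 𝓕 semicircle ξ) =
      fun ξ : ℝ => (1 / 2 : ℂ) * (Complex.exp (↑(2 * π * ξ * s) * Complex.I) * 𝓕 semicircle ξ +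
        Complex.exp (↑(-2 * π * ξ * s) * Complex.I) * 𝓕 semicircle ξ) := by
    funext ξ
    rw [Complex.ofReal_cos, Complex.cos]
    push_cast
    ring_nf
  rw [hcos, MeasureTheory.integral_const_mul, integral_add (hb 2) (hb (-2)), h1, h2]
  ring


/-! ## The Weber–Schafheitlin integral `∫₀^∞ J₀(y) J₁(y) / y dy = 2/π` -/

/-- The pairing `I = ∫ J₀(2πξ) 𝓕g(ξ) dξ` of the Fourier transform of the arcsine law (`J₀(2π·)`,
by Poisson's integral) with that of the semicircle equals `2/π`: insert
`J₀(2πξ) = π⁻¹ ∫₀^π cos(2πξ cos θ) dθ`, exchange the integrals (Fubini: `𝓕g` is integrable), and use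
Fourier inversion in cosine form at the points `s = cos θ`:
`I = π⁻¹ ∫₀^π √(1 - cos²θ) dθ = π⁻¹ ∫₀^π sin θ dθ = 2/π`. This is Parseval's relation
`∫ 𝓕μ · 𝓕g = ∫ g dμ = ∫_{-1}^{1} √(1-t²) dt/(π√(1-t²)) = 2/π` for the arcsine law `μ`. [folklore] -/
theorem integral_besselJ_zero_mul_fourier_semicircle :
    ∫ ξ : ℝ, (besselJ 0 (2 * π * ξ) : ℂ) * 𝓕 semicircle ξ = 2 / π := by
  set H : ℝ → ℝ → ℂ := fun ξ θ => (Real.cos (2 * π * ξ * cos θ) : ℂ) * 𝓕 semicircle ξ with hH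
  -- Step 1: Poisson's integral for `J₀`
  have h1 : ∀ ξ : ℝ, (besselJ 0 (2 * π * ξ) : ℂ) * 𝓕 semicircle ξ =
      (π⁻¹ : ℂ) * ∫ θ in (0 : ℝ)..π, H ξ θ := by
    intro ξ
    rw [besselJ_zero_eq_integral_cos_mul_cos, hH]
    rw [intervalIntegral.integral_mul_const, intervalIntegral.integral_ofReal]
    push_cast
    ring
  simp_rw [h1]
  rw [MeasureTheory.integral_const_mul]
  -- Step 2: Fubini
  have hHc : Continuous (Function.uncurry H) := by
    rw [hH]
    exact (Complex.continuous_ofReal.comp (by fun_prop)).mul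
      (continuous_fourier_semicircle.comp continuous_fst)
  have hswap : ∫ ξ : ℝ, ∫ θ in (0 : ℝ)..π, H ξ θ = ∫ θ in (0 : ℝ)..π, ∫ ξ : ℝ, H ξ θ := by
    simp_rw [intervalIntegral.integral_of_le pi_pos.le]
    refine MeasureTheory.integral_integral_swap ?_
    have hprod : Integrable (fun z : ℝ × ℝ => ‖𝓕 semicircle z.1‖ * (1 : ℝ))
        ((volume : Measure ℝ).prod ((volume : Measure ℝ).restrict (Ioc 0 π))) :=
      integrable_fourier_semicircle.norm.mul_prod
        (integrableOn_const (by exact measure_Ioc_lt_top.ne))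
    refine hprod.mono' hHc.aestronglyMeasurable (ae_of_all _ ?_)
    rintro ⟨ξ, θ⟩
    rw [hH]
    simp only [Function.uncurry_apply_pair, norm_mul, Complex.norm_real, Real.norm_eq_abs, mul_one]
    exact mul_le_of_le_one_left (norm_nonneg _) (abs_cos_le_one _)
  rw [hswap]
  -- Step 3: Fourier inversion in cosine form at `s = cos θ`
  have hinner : ∀ θ : ℝ, ∫ ξ : ℝ, H ξ θ = semicircle (cos θ) := fun θ =>
    integral_cos_mul_fourier_semicircle (cos θ)
  simp_rw [hinner]
  -- Step 4: `∫₀^π √(1 - cos²θ) dθ = ∫₀^π sin θ dθ = 2`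
  have h4 : ∫ θ in (0 : ℝ)..π, semicircle (cos θ) = 2 := by
    rw [intervalIntegral.integral_congr (g := fun θ => ((sin θ : ℝ) : ℂ)) ?_,
      intervalIntegral.integral_ofReal, integral_sin, cos_zero, cos_pi]
    · push_cast; ring
    · intro θ hθ
      rw [uIcc_of_le pi_pos.le] at hθ
      simp only [semicircle, (sin_eq_sqrt_one_sub_cos_sq hθ.1 hθ.2).symm]
  rw [h4]
  field_simp

/-- The same pairing computed directly: off the origin `𝓕g(ξ) = π J₁(2πξ)/(2πξ)`, so after the
substitution `y = 2πξ` and by the evenness of `J₀(y) J₁(y)/y`,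
`I = (1/2) ∫_ℝ J₀(y) J₁(y)/y dy = ∫₀^∞ J₀(y) J₁(y)/y dy`. [folklore] -/
theorem integral_besselJ_zero_mul_fourier_semicircle_eq_integral_Ioi :
    ∫ ξ : ℝ, (besselJ 0 (2 * π * ξ) : ℂ) * 𝓕 semicircle ξ =
      ((∫ y in Ioi (0 : ℝ), besselJ 0 y * besselJ 1 y / y : ℝ) : ℂ) := by
  set F : ℝ → ℝ := fun y => besselJ 0 y * (π * (besselJ 1 y / y)) with hF
  have hae : (fun ξ : ℝ => (besselJ 0 (2 * π * ξ) : ℂ) * 𝓕 semicircle ξ) =ᵐ[volume]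
      fun ξ => ((F (2 * π * ξ) : ℝ) : ℂ) := by
    have h0 : ∀ᵐ ξ : ℝ, ξ ≠ 0 := by
      rw [ae_iff]; simp
    filter_upwards [h0] with ξ hξ
    rw [fourier_semicircle_eq_besselJ_one_div hξ, hF]
    push_cast
    ring
  rw [integral_congr_ae hae, integral_complex_ofReal]
  congr 1
  rw [Measure.integral_comp_mul_left F (2 * π)]
  have hFint : ∫ y, F y = π * ∫ y, besselJ 0 y * besselJ 1 y / y := by
    rw [← MeasureTheory.integral_const_mul]
    congr 1
    funext y
    rw [hF]
    ring
  have heven : ∫ y, besselJ 0 y * besselJ 1 y / y =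
      2 * ∫ y in Ioi (0 : ℝ), besselJ 0 y * besselJ 1 y / y := by
    rw [← integral_comp_abs]
    congr 1
    funext y
    rcases le_or_gt 0 y with hy | hy
    · rw [abs_of_nonneg hy]
    · rw [abs_of_neg hy, besselJ_neg 0, besselJ_neg 1, pow_zero, pow_one, one_mul, neg_one_mul,
        mul_neg, neg_div_neg_eq]
  rw [hFint, heven, smul_eq_mul, abs_inv, abs_of_pos (by positivity : (0 : ℝ) < 2 * π)]
  field_simp

/-- **Weber–Schafheitlin integral** (critical case `μ = 0`, `ν = 1`, `λ = 1`):
`∫₀^∞ J₀(y) J₁(y) / y dy = 2/π` (Andrews–Askey–Roy, Exercise 4.15 with `a = 1`, `α = β = 1/2`,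
`γ = 2`: `Γ(1)Γ(1/2)/(2Γ(1/2)Γ(3/2)²) = 2/π`; Watson §13.42). Obtained here by computing the pairing
`∫ J₀(2πξ) 𝓕g(ξ) dξ` of the Fourier transforms of the arcsine and semicircle laws in two ways
(`Literature.Analysis.FunctionSpaces.integral_besselJ_zero_mul_fourier_semicircle`,
`Literature.Analysis.FunctionSpaces.integral_besselJ_zero_mul_fourier_semicircle_eq_integral_Ioi`). [cite: AndrewsAskeyRoy1999, Exercise 4.15] -/
theorem integral_Ioi_besselJ_zero_mul_besselJ_one_div :
    ∫ y in Ioi (0 : ℝ), besselJ 0 y * besselJ 1 y / y = 2 / π := by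
  have h := integral_besselJ_zero_mul_fourier_semicircle
  rw [integral_besselJ_zero_mul_fourier_semicircle_eq_integral_Ioi] at h
  exact_mod_cast h

/-- `J₀(y) J₁(y) / y` is integrable on `(0, ∞)`. [folklore] -/
theorem integrableOn_besselJ_zero_mul_besselJ_one_div :
    IntegrableOn (fun y : ℝ => besselJ 0 y * besselJ 1 y / y) (Ioi 0) :=
  integrable_besselJ_zero_mul_besselJ_one_div.integrableOn

/-! ## The companion integral `∫₀^∞ J₁(y) / y dy = 1` -/

/-- **`∫₀^∞ J₁(y)/y dy = 1`** (Lieb–Wu, Physica A 321 (2003) 1, §7: `μ₋(0) = 2 - 2∫₀^∞ J₁(ω)/ω dω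
= 0`, quoted there from Gradshteyn–Ryzhik; Watson §13.42). Obtained here from Fourier inversion for
the semicircle at `s = 0`: `∫ 𝓕g(ξ) dξ = g(0) = 1`, while `𝓕g(ξ) = π J₁(2πξ)/(2πξ)` off the origin,
so that `∫ 𝓕g = (1/2) ∫_ℝ J₁(y)/y dy = ∫₀^∞ J₁(y)/y dy` (substitution `y = 2πξ`, evenness). This is
the Bessel input for the vanishing of the Lieb–Wu charge gap at `U = 0`
(`Literature.Analysis.FunctionSpaces.liebWuChargeGap_zero`). [cite: LiebWuPhysicaA2003, §7, display μ₋(0) = 2 - 2∫₀^∞ J₁(ω)/ω dω = 0] -/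
theorem integral_Ioi_besselJ_one_div : ∫ y in Ioi (0 : ℝ), besselJ 1 y / y = 1 := by
  have h1 : ∫ ξ : ℝ, 𝓕 semicircle ξ = 1 := by
    have h := integral_cos_mul_fourier_semicircle 0
    simp only [mul_zero, Real.cos_zero, Complex.ofReal_one, one_mul] at h
    rw [h, semicircle]
    simp
  have h2 : ∫ ξ : ℝ, 𝓕 semicircle ξ = ((∫ y in Ioi (0 : ℝ), besselJ 1 y / y : ℝ) : ℂ) := by
    set F : ℝ → ℝ := fun y => π * (besselJ 1 y / y) with hF
    have hae : (𝓕 semicircle : ℝ → ℂ) =ᵐ[volume] fun ξ => ((F (2 * π * ξ) : ℝ) : ℂ) := by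
      have h0 : ∀ᵐ ξ : ℝ, ξ ≠ 0 := by
        rw [ae_iff]; simp
      filter_upwards [h0] with ξ hξ
      rw [fourier_semicircle_eq_besselJ_one_div hξ, hF]
    rw [integral_congr_ae hae, integral_complex_ofReal]
    congr 1
    rw [Measure.integral_comp_mul_left F (2 * π)]
    have hFint : ∫ y, F y = π * ∫ y, besselJ 1 y / y := by
      rw [← MeasureTheory.integral_const_mul]
    have heven : ∫ y, besselJ 1 y / y = 2 * ∫ y in Ioi (0 : ℝ), besselJ 1 y / y := by
      rw [← integral_comp_abs]
      congr 1
      funext y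
      rcases le_or_gt 0 y with hy | hy
      · rw [abs_of_nonneg hy]
      · rw [abs_of_neg hy, besselJ_neg 1, pow_one, neg_one_mul, neg_div_neg_eq]
    rw [hFint, heven, smul_eq_mul, abs_inv, abs_of_pos (by positivity : (0 : ℝ) < 2 * π)]
    field_simp
  exact_mod_cast h2.symm.trans h1

/-- `J₁(y) / y` is integrable on `(0, ∞)` (indeed on `ℝ`: `|J₁(y)/y| ≤ K (1+|y|)^{-3/2}`). [folklore] -/
theorem integrableOn_besselJ_one_div : IntegrableOn (fun y : ℝ => besselJ 1 y / y) (Ioi 0) := by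
  obtain ⟨K, hK0, hK⟩ := exists_abs_besselJ_one_div_le
  have hmeas : AEStronglyMeasurable (fun y : ℝ => besselJ 1 y / y) volume :=
    ((continuous_besselJ_holds 1).measurable.div measurable_id).aestronglyMeasurable
  have hint : Integrable (fun y : ℝ => K * (1 + ‖y‖) ^ (-(3 / 2 : ℝ))) :=
    (integrable_one_add_norm (by rw [Module.finrank_self]; norm_num)).const_mul K
  refine (hint.mono' hmeas ?_).integrableOn
  have h0 : ∀ᵐ y : ℝ, y ≠ 0 := by
    rw [ae_iff]; simp
  filter_upwards [h0] with y hy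
  rw [Real.norm_eq_abs, Real.norm_eq_abs]
  exact hK y hy

end Literature.Analysis.FunctionSpaces
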